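import Literature.Analysis.ODE.ThreeTermLadderGauge
import Summits.AnomalousDissipation.AnomalousDissipation.Theorems.SolenoidalFractalHomogenisationRealisedQuasiStaticCellLawPrincipalLadder
import HarnessLib

/-!
# K2R `RealisedQuasiStaticCellLaw`, line `floquet-bloch`: the out-of-plane block of a principal ladder, gauged into the
# real antisymmetric form consumed by the ladder functional (helper towards `stub_lowSectorDecay` / `stub_upperSome`;
# `--supports stmt-AnomalousDissipation-20446`)

Summits-side helper file (everything proved; no definitions, no named facts). Along the Galerkin truncation of order
`N` of the cell problem (`pvSetup_cell`, all carrier modes resolved) and inside a time window `[a, b] ⊆ [0, T]` lying in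
slot `j`, the out-of-plane components `u_J(t) = ⟪ζ, α_N(t)(k₀ + J•K_j)⟫` of a coset `k₀ + ℤK_j` (`ζ ⊥ k₀, K_j`) obey the
scalar three-term ladder of `…PrincipalLadder`; the layer amplitudes are conjugate (`conj a_j = a'_j`,
`layerAmp_conj`), so the diagonal unitary gauge of `Literature.Analysis.ODE.ThreeTermLadder` applies: the gauged
components `v_J = μ_j^{-J} u_J` (`μ_j = i a_j/|a_j|`) satisfy, for `J` in the finite segment
`Jset = {J | k₀ + J•K_j ∈ freqBall N}` and with `v = 0` off it,
`v_J' = -Λ_j (d_J v_J + g_j(t) (v_{J-1} - v_{J+1}))`, `Λ_j = κ·4π²|K_j|²`, `d_J = |k₀ + J•K_j|²/|K_j|²`,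
`g_j(t) = 2π(ê_j·k₀)|a_j| c_j(t)/Λ_j` (`hasDerivWithinAt_gauged_outOfPlane`), i.e. — packaged over `↥Jset` with the
tridiagonal matrix — exactly the hypotheses `hcont`/`hderiv` of `ladderFunctional_decay` (`outOfPlane_ladder_block`), the
block energy being the plain coefficient energy of the modes (`sum_norm_sq_gauged_outOfPlane`).
-/

set_option linter.dupNamespace false

noncomputable section

namespace Summit.AnomalousDissipation.AnomalousDissipation.Theorems.SolenoidalFractalHomogenisation.RealisedQuasiStaticCellLaw

open Set MeasureTheory Filter Topology Function Complex
open scoped InnerProductSpace ComplexConjugate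
open Literature.Analysis Literature.Analysis.FunctionSpaces Literature.Analysis.FunctionSpaces.Torus
open Literature.Analysis.FluidPDE Literature.Analysis.FluidPDE.LatticeShear
open Literature.Analysis.ODE.ThreeTermLadder

variable {k₀ : ℕ}

/-! ### The layer amplitude of a slot -/

/-- The two layer amplitudes of a slot are complex conjugate: `conj (e^{iφ}/(2Ri)) = -e^{-iφ}… = a'`. -/
theorem layerAmp_conj (P : LatticePhase) :
    conj (Complex.exp (P.φ * Complex.I) * (1 / (2 * ((2 * Real.pi * ‖latticeVec P.m‖ : ℝ) : ℂ) * Complex.I))) =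
      starRingEnd ℂ (Complex.exp (P.φ * Complex.I)) *
        (-(1 / (2 * ((2 * Real.pi * ‖latticeVec P.m‖ : ℝ) : ℂ) * Complex.I))) := by
  rw [map_mul]
  congr 1
  rw [map_div₀, map_one, map_mul, map_mul, Complex.conj_I, Complex.conj_ofReal]
  have h2 : conj (2 : ℂ) = 2 := by
    rw [show (2 : ℂ) = ((2 : ℝ) : ℂ) by norm_num, Complex.conj_ofReal]
  rw [h2]
  ring

/-- The layer amplitude is non-zero. -/
theorem layerAmp_ne_zero (P : LatticePhase) :
    Complex.exp (P.φ * Complex.I) * (1 / (2 * ((2 * Real.pi * ‖latticeVec P.m‖ : ℝ) : ℂ) * Complex.I)) ≠ 0 := by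
  have hR : (2 * Real.pi * ‖latticeVec P.m‖) ≠ 0 := by
    have := one_le_norm_latticeVec P.m_ne
    positivity
  have hR' : ((2 * Real.pi * ‖latticeVec P.m‖ : ℝ) : ℂ) ≠ 0 := by exact_mod_cast hR
  refine mul_ne_zero (Complex.exp_ne_zero _) ?_
  exact one_div_ne_zero (mul_ne_zero (mul_ne_zero two_ne_zero hR') Complex.I_ne_zero)

/-- The modulus of the layer amplitude: `|a_j| = 1/(2·2π|m_j|)`. -/
theorem norm_layerAmp (P : LatticePhase) :
    ‖Complex.exp (P.φ * Complex.I) * (1 / (2 * ((2 * Real.pi * ‖latticeVec P.m‖ : ℝ) : ℂ) * Complex.I))‖ =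
      1 / (2 * (2 * Real.pi * ‖latticeVec P.m‖)) := by
  have hR : 0 < 2 * Real.pi * ‖latticeVec P.m‖ := by
    have := one_le_norm_latticeVec P.m_ne
    positivity
  rw [norm_mul, Complex.norm_exp_ofReal_mul_I, one_mul, norm_div, norm_one, norm_mul, norm_mul, Complex.norm_I,
    mul_one, Complex.norm_real, Real.norm_eq_abs, abs_of_pos hR]
  norm_num

/-! ### The gauged out-of-plane components -/

/-- **The gauged out-of-plane ladder along the Galerkin solution** (one mode, within `[0,T]`): with
`u_J(t) = ⟪ζ, α_N(t)(k₀ + J•K_j)⟫`, `μ_j = i a_j/|a_j|`, `v_J = μ_j^{-J} u_J`, for `t ∈ [0,T]` in slot `j` and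
`k₀ + J•K_j ∈ freqBall N`,
`v_J' = -Λ_j (d_J v_J(t) + g_j(t) (v_{J-1}(t) - v_{J+1}(t)))` within `[0,T]` at `t`, where `Λ_j = κ4π²|K_j|²`,
`d_J = |k₀ + J•K_j|²/|K_j|²`, `g_j(t) = 2π(ê_j·k₀)|a_j|c_j(t)/Λ_j`, `c_j(t) = (1/n)trap_j(r(t))`
(`|a_j| = 1/(2·2π|m_j|)`, `norm_layerAmp`). -/
theorem hasDerivWithinAt_gauged_outOfPlane (W : LatticeWord k₀) {n : ℕ} (hn : 0 < n) {κ : ℝ} (hκ : 0 < κ)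
    (ℓ : Fin 3 → ℤ) {w₀ : UnitAddTorus (Fin 3) → EuclideanSpace ℝ (Fin 3)}
    (hw₀ : FunctionSpaces.Torus.MemSobolev 1 (FunctionSpaces.EuclideanSpace.complexify ∘ w₀))
    (hdiv : FunctionSpaces.Torus.IsWeaklyDivFree w₀) (hmean : FunctionSpaces.Torus.HasZeroMean w₀)
    (hsupp : ∀ k : Fin 3 → ℤ, ¬ ((∃ z : Fin 3 → ℤ, k = ℓ + (n:ℤ) • z) ∨ (∃ z : Fin 3 → ℤ, k = -ℓ + (n:ℤ) • z)) →
      UnitAddTorus.mFourierCoeff (FunctionSpaces.EuclideanSpace.complexify ∘ w₀) k = 0)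
    {N : ℕ} (hBN : (Finset.univ.biUnion fun j : Fin k₀ =>
        ({(fun i => (W.phase j).m i * n), -(fun i => (W.phase j).m i * n)} : Finset (Fin 3 → ℤ))) ⊆ freqBall N)
    {T t : ℝ} (htT : t ∈ Icc 0 T) (j : Fin k₀)
    (ht : Int.fract (t / W.period) * W.period ∈ Icc (W.start j) (W.start j + (W.phase j).τ))
    (k0 : Fin 3 → ℤ) {ζ : EuclideanSpace ℂ (Fin 3)} (hζ₀ : ∑ i, (k0 i : ℂ) * ζ i = 0)
    (hζK : ∑ i, (((fun i => (W.phase j).m i * (n : ℤ)) i : ℤ) : ℂ) * ζ i = 0) (J : ℤ)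
    (hJ : k0 + J • (fun i => (W.phase j).m i * (n : ℤ)) ∈ freqBall N) :
    HasDerivWithinAt
      (fun τ => (Complex.I * (Complex.exp ((W.phase j).φ * Complex.I) *
          (1 / (2 * ((2 * Real.pi * ‖latticeVec (W.phase j).m‖ : ℝ) : ℂ) * Complex.I))) /
          (‖Complex.exp ((W.phase j).φ * Complex.I) *
            (1 / (2 * ((2 * Real.pi * ‖latticeVec (W.phase j).m‖ : ℝ) : ℂ) * Complex.I))‖ : ℂ)) ^ (-J) *
        inner ℂ ζ ((pvSetup_cell W hn hκ.le ℓ hw₀ hdiv hmean hsupp).galerkinCoeffAt N τ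
          (k0 + J • (fun i => (W.phase j).m i * (n : ℤ)))))
      (-((κ * (4 * Real.pi ^ 2 * freqNormSq (fun i => (W.phase j).m i * (n : ℤ))) : ℝ) : ℂ) *
        (((freqNormSq (k0 + J • (fun i => (W.phase j).m i * (n : ℤ))) /
              freqNormSq (fun i => (W.phase j).m i * (n : ℤ)) : ℝ) : ℂ) *
            ((Complex.I * (Complex.exp ((W.phase j).φ * Complex.I) *
                (1 / (2 * ((2 * Real.pi * ‖latticeVec (W.phase j).m‖ : ℝ) : ℂ) * Complex.I))) /
                (‖Complex.exp ((W.phase j).φ * Complex.I) *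
                  (1 / (2 * ((2 * Real.pi * ‖latticeVec (W.phase j).m‖ : ℝ) : ℂ) * Complex.I))‖ : ℂ)) ^ (-J) *
              inner ℂ ζ ((pvSetup_cell W hn hκ.le ℓ hw₀ hdiv hmean hsupp).galerkinCoeffAt N t
                (k0 + J • (fun i => (W.phase j).m i * (n : ℤ))))) +
          (((2 * Real.pi * (∑ i, (W.phase j).e i * (k0 i : ℝ)) *
                ‖Complex.exp ((W.phase j).φ * Complex.I) *
                  (1 / (2 * ((2 * Real.pi * ‖latticeVec (W.phase j).m‖ : ℝ) : ℂ) * Complex.I))‖ *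
                ((1 / (n : ℝ)) * LatticeWord.trapezoid (W.start j) (W.phase j).τ W.ramp
                  (Int.fract (t / W.period) * W.period)) /
              (κ * (4 * Real.pi ^ 2 * freqNormSq (fun i => (W.phase j).m i * (n : ℤ)))) : ℝ) : ℂ) *
            ((Complex.I * (Complex.exp ((W.phase j).φ * Complex.I) *
                (1 / (2 * ((2 * Real.pi * ‖latticeVec (W.phase j).m‖ : ℝ) : ℂ) * Complex.I))) /
                (‖Complex.exp ((W.phase j).φ * Complex.I) *
                  (1 / (2 * ((2 * Real.pi * ‖latticeVec (W.phase j).m‖ : ℝ) : ℂ) * Complex.I))‖ : ℂ)) ^ (-(J - 1)) *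
                inner ℂ ζ ((pvSetup_cell W hn hκ.le ℓ hw₀ hdiv hmean hsupp).galerkinCoeffAt N t
                  (k0 + (J - 1) • (fun i => (W.phase j).m i * (n : ℤ)))) -
              (Complex.I * (Complex.exp ((W.phase j).φ * Complex.I) *
                (1 / (2 * ((2 * Real.pi * ‖latticeVec (W.phase j).m‖ : ℝ) : ℂ) * Complex.I))) /
                (‖Complex.exp ((W.phase j).φ * Complex.I) *
                  (1 / (2 * ((2 * Real.pi * ‖latticeVec (W.phase j).m‖ : ℝ) : ℂ) * Complex.I))‖ : ℂ)) ^ (-(J + 1)) *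
                inner ℂ ζ ((pvSetup_cell W hn hκ.le ℓ hw₀ hdiv hmean hsupp).galerkinCoeffAt N t
                  (k0 + (J + 1) • (fun i => (W.phase j).m i * (n : ℤ))))))))
      (Icc 0 T) t := by
  have hA0 := layerAmp_ne_zero (W.phase j)
  set hPV := pvSetup_cell W hn hκ.le ℓ hw₀ hdiv hmean hsupp with hPVdef
  set K : Fin 3 → ℤ := fun i => (W.phase j).m i * (n : ℤ) with hK
  -- the raw scalar ladder
  have h1 := hasDerivWithinAt_inner_galerkinCoeffAt_slot W hn hκ.le ℓ hw₀ hdiv hmean hsupp hBN htT j ht k0 hζ₀ hζK J hJ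
  -- the coupling scalar is real: `∑ᵢ (complexify e)ᵢ k0ᵢ = ((∑ᵢ eᵢ k0ᵢ : ℝ) : ℂ)`
  have hθ : ∑ i, (EuclideanSpace.complexify (W.phase j).e) i * (k0 i : ℂ) =
      ((∑ i, (W.phase j).e i * (k0 i : ℝ) : ℝ) : ℂ) := by
    push_cast
    refine Finset.sum_congr rfl fun i _ => ?_
    rw [EuclideanSpace.complexify_apply]
  -- bring the raw ladder to the gauge input shape `-D u - (r I)(A u₋ + conj A u₊)`
  have h2 : HasDerivWithinAt (fun τ => inner ℂ ζ (hPV.galerkinCoeffAt N τ (k0 + J • K)))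
      (-(((κ * (4 * Real.pi ^ 2 * freqNormSq (k0 + J • K))) : ℝ) : ℂ) * inner ℂ ζ (hPV.galerkinCoeffAt N t (k0 + J • K)) -
        ((((2 * Real.pi * (∑ i, (W.phase j).e i * (k0 i : ℝ)) *
            ((1 / (n : ℝ)) * LatticeWord.trapezoid (W.start j) (W.phase j).τ W.ramp
              (Int.fract (t / W.period) * W.period))) : ℝ) : ℂ) * Complex.I) *
          (Complex.exp ((W.phase j).φ * Complex.I) *
              (1 / (2 * ((2 * Real.pi * ‖latticeVec (W.phase j).m‖ : ℝ) : ℂ) * Complex.I)) *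
              inner ℂ ζ (hPV.galerkinCoeffAt N t (k0 + (J - 1) • K)) +
            conj (Complex.exp ((W.phase j).φ * Complex.I) *
              (1 / (2 * ((2 * Real.pi * ‖latticeVec (W.phase j).m‖ : ℝ) : ℂ) * Complex.I))) *
              inner ℂ ζ (hPV.galerkinCoeffAt N t (k0 + (J + 1) • K)))) (Icc 0 T) t := by
    refine h1.congr_deriv ?_
    rw [hθ, layerAmp_conj (W.phase j)]
    push_cast
    ring
  -- gauge
  have h3 := HasDerivWithinAt.gauge_ladder (u := fun τ J' => inner ℂ ζ (hPV.galerkinCoeffAt N τ (k0 + J' • K)))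
    (J := J) hA0 h2
  refine h3.congr_deriv ?_
  -- match the F2 normalisation `-Λ (d v + g (v₋ - v₊))`: pure algebra in the casts
  have hK0 : K ≠ 0 := cellFreq_ne_zero (W.phase j) hn
  have hKpos : 0 < freqNormSq K := by
    obtain ⟨i, hi⟩ : ∃ i, K i ≠ 0 := by
      by_contra h
      push Not at h
      exact hK0 (funext h)
    have hi' : (K i : ℝ) ≠ 0 := by exact_mod_cast hi
    unfold freqNormSq
    exact lt_of_lt_of_le (by positivity) (Finset.single_le_sum (fun l _ => sq_nonneg ((K l : ℝ))) (Finset.mem_univ i))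
  have hKc : ((freqNormSq K : ℝ) : ℂ) ≠ 0 := by exact_mod_cast hKpos.ne'
  have hκc : ((κ : ℝ) : ℂ) ≠ 0 := by exact_mod_cast hκ.ne'
  have hπc : ((Real.pi : ℝ) : ℂ) ≠ 0 := by exact_mod_cast Real.pi_pos.ne'
  generalize (Complex.I * (Complex.exp ((W.phase j).φ * Complex.I) *
      (1 / (2 * ((2 * Real.pi * ‖latticeVec (W.phase j).m‖ : ℝ) : ℂ) * Complex.I))) /
      (‖Complex.exp ((W.phase j).φ * Complex.I) *
        (1 / (2 * ((2 * Real.pi * ‖latticeVec (W.phase j).m‖ : ℝ) : ℂ) * Complex.I))‖ : ℂ)) ^ (-J) = μ₁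
  generalize (Complex.I * (Complex.exp ((W.phase j).φ * Complex.I) *
      (1 / (2 * ((2 * Real.pi * ‖latticeVec (W.phase j).m‖ : ℝ) : ℂ) * Complex.I))) /
      (‖Complex.exp ((W.phase j).φ * Complex.I) *
        (1 / (2 * ((2 * Real.pi * ‖latticeVec (W.phase j).m‖ : ℝ) : ℂ) * Complex.I))‖ : ℂ)) ^ (-(J - 1)) = μ₂
  generalize (Complex.I * (Complex.exp ((W.phase j).φ * Complex.I) *
      (1 / (2 * ((2 * Real.pi * ‖latticeVec (W.phase j).m‖ : ℝ) : ℂ) * Complex.I))) /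
      (‖Complex.exp ((W.phase j).φ * Complex.I) *
        (1 / (2 * ((2 * Real.pi * ‖latticeVec (W.phase j).m‖ : ℝ) : ℂ) * Complex.I))‖ : ℂ)) ^ (-(J + 1)) = μ₃
  generalize (‖Complex.exp ((W.phase j).φ * Complex.I) *
      (1 / (2 * ((2 * Real.pi * ‖latticeVec (W.phase j).m‖ : ℝ) : ℂ) * Complex.I))‖ : ℝ) = nA
  push_cast
  field_simp
  ring

end Summit.AnomalousDissipation.AnomalousDissipation.Theorems.SolenoidalFractalHomogenisation.RealisedQuasiStaticCellLaw

end
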